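import Summits.HodgeConjecture.HodgeConjecture.Theorems.F0P3cStCharTSWeylHypWIFJac          -- ★ p849989 (LH2-p02 g3) «(WIF) ⟸ JAC» (global socket): `isCompact_isOpen_compactCore_cmTorus`, `ae_isRegularElt_cmTorus`; brings ★ WeylHypWIF glue, ★ p849811
import Summits.HodgeConjecture.HodgeConjecture.Theorems.F0P3cStCharTSWeylHypJacobianLocal   -- ★ p851645 (LH6-p03 g5) (J0): `integral_hypSet_eq_of_tubeJacobian_local`
import HarnessLib

/-!
# F0 · P3c · line LH6 «StCharTS» — ROAD «JAC-LOC» brick (J6-pre) «(WIF) ⟸ JAC-LOC»: the leaf's Weyl-integration socket on the hyperbolic set in DENSITY form, from the LOCAL tube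
# Jacobian (Rogawski 1990 §12.5 p. 182; Harish-Chandra 1970 Lemmas 22 ∕ 42) — the local twin of ★ p849989

Cell `pub/hodgecm-mathlib`, crux H413 = `stmt-HodgeConjecture-24833` (lane `--supports … --as helper`), route HCCMUnconditional; seat LH6-p02 (g6), brick (J6-pre) of the road
«JAC-LOC» (holder LH6-p03 (g5); memo `F0/P3b/LH6-p03/g5/ROAD-JAC-LOC.v2.LH6p03g5.md` §0 row «(WIF) density on Ω ⟸ hJac … local variant», §2 (J6) «ASSEMBLY … then the local twin of
★ p849989»).  THEOREMS ONLY; sorry-free; no definition ∕ instance ∕ notation; axioms TRIO.  CONDITIONAL on the LOCAL socket «JAC-LOC» (`hJacLoc`, BY SHAPE = ★ p851645's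
`integral_hypSet_eq_of_tubeJacobian_local` under ★ p849989's `∀ tT` prefix, tubes written `Φ`-free as in ★ p849989), which the road (J1)–(J5) discharges at every regular `t₀`.
THE RESULT **`integral_mul_eq_integral_classOrbitalIntegral_density_of_tubeJacobian_local`**: ★ p849989's statement VERBATIM with `hJac` ↦ `hJacLoc` — for THE normalised torus measure
`tT` (Haar, inversion-invariant, mass `1` on `compactCore T`) and EVERY regular `t₀ ∈ T`, an open `U ∋ t₀`, a measurable `A₀ ⊆ G ⧸ T` of positive finite `ν∕tT`-measure such that for
every measurable `W`-free `V ⊆ U ∩ T^{reg}` the tube `{x t x⁻¹ | xT ∈ A₀, t ∈ V}` has Haar measure `(ν∕tT)(A₀) · ∫⁻_V D dtT` ⟹ for every measurable locally integrable `α` conjugation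
invariant on `hyperbolicSet L v` and every `φ` with `IsLocSmooth φ`, `tsupport φ ⊆ hyperbolicSet L v`:
**`∫ φ·α dν = ∫_M classOrbitalIntegral mQv φ ⟦ι m⟧ · (ρ(m) · α(ι m)) dμM`,  `ρ m := (2 · c₀.toReal)⁻¹ · D(ι m)`,  `c₀ := (ι_* μM)(compactCore T)`**.
Proof: ★ p849989's, verbatim, with ★ p851645 `integral_hypSet_eq_of_tubeJacobian_local` in place of ★ p849811 `integral_hypSet_eq_of_tubeJacobian`.
HONEST LABEL: count-neutral; CONDITIONAL on «JAC-LOC»; closes no organ.  HC_CM is proved only modulo the 7 printed citations (2 remaining: hLiu418 =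
`stmt-HodgeConjecture-24832`, h413 = `stmt-HodgeConjecture-24833`) until rung 0 closes.

## References
* [Rogawski1990] J. D. Rogawski, *Automorphic Representations of Unitary Groups in Three Variables*, Ann. of Math. Stud. 123 (1990), §12.5 p. 182; §12.7 L. 12.7.2
  (proof) p. 193; §4.3 (4.3.1) p. 43.
* [HarishChandra1970] Harish-Chandra, *Harmonic analysis on reductive p-adic groups*, LNM 162 (1970), Lemma 22, Lemma 42.
* [DeitmarEchterhoff2014] A. Deitmar, S. Echterhoff, *Principles of Harmonic Analysis*, 2nd ed. (2014), Thm. 1.5.3.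
-/

set_option autoImplicit false
set_option linter.dupNamespace false

noncomputable section

open MeasureTheory Measure Set Filter Topology Function NumberField IsDedekindDomain Matrix Polynomial
open Literature.MeasureTheory.Group
open Literature.NumberTheory.Automorphic Literature.NumberTheory.Automorphic.UnitaryGroup Literature.NumberTheory.Rogawski1990
open Summit.HodgeConjecture.HodgeConjecture.Cruxes.H413.F0P3cStCharTSWeylHypFibre
open Summit.HodgeConjecture.HodgeConjecture.Cruxes.H413.F0P3cStCharTSWeylHypTorsor
open Summit.HodgeConjecture.HodgeConjecture.Cruxes.H413.F0P3cStCharTSWeylHypCM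
open Summit.HodgeConjecture.HodgeConjecture.Cruxes.H413.F0P3cStCharTSWeylHypMeasure
open Summit.HodgeConjecture.HodgeConjecture.Cruxes.H413.F0P3cStCharTSWeylHypJacobian
open Summit.HodgeConjecture.HodgeConjecture.Cruxes.H413.F0P3cStCharTSWeylHypWIF
open Summit.HodgeConjecture.HodgeConjecture.Cruxes.H413.F0P3cStCharTSWeylHypJacobianLocal
open Summit.HodgeConjecture.HodgeConjecture.Cruxes.H413.F0P3cStCharTSWeylHypWIFJac
open Summit.HodgeConjecture.HodgeConjecture.Cruxes.H413.F0P3cStCharTSTorusDefs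
open Summit.HodgeConjecture.HodgeConjecture.Cruxes.H413.F0P3cStCharTSTorusChartIso
open scoped ENNReal NNReal MatrixGroups Pointwise

namespace Summit.HodgeConjecture.HodgeConjecture.Cruxes.H413.F0P3cStCharTSWeylHypWIFJacLocal

section CM

variable (L : Type) [Field L] [NumberField L] [IsCMField L] (v : HeightOneSpectrum (𝓞 ↥(maximalRealSubfield L)))

set_option maxHeartbeats 1600000 in
set_option synthInstance.maxHeartbeats 400000 in
-- instance-term unification at the CM carrier (`quotientMeasure` ∕ canonical family), as in ★ p849989
/-- **«(WIF) ⟸ JAC-LOC»: THE LEAF's WEYL-INTEGRATION SOCKET ON THE HYPERBOLIC SET IN DENSITY FORM, FROM THE LOCAL TUBE JACOBIAN** (`v` non-split; the socket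
«JAC-LOC» = `hJacLoc` is ★ p851645's local tube Jacobian under ★ p849989's `∀ tT` prefix, see the module docstring).  For every Haar measure `μM` on `M = E_vˣ × E¹_v`, every
measurable locally `ν`-integrable `α` conjugation invariant on `hyperbolicSet L v` and every `φ` with `IsLocSmooth φ`, `tsupport φ ⊆ hyperbolicSet L v`:
**`∫ φ·α dν = ∫_M classOrbitalIntegral mQv φ ⟦ι m⟧ · (ρ m · α(ι m)) dμM`, `ρ m = (2 · ((ι_*μM)(compactCore T)).toReal)⁻¹ · D(ι m)`** — ★ p851645 at THE normalised torus
measure `tT = c₀⁻¹ • ι_*μM`, then ★ p849989's proof verbatim (★ p849936 glue, ★ `ae_isRegularElt_cmTorus`, ★ `integral_comp_torusChart`).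
[cite: Rogawski1990, §12.5 p. 182; §12.7 L. 12.7.2 (proof) p. 193] [cite: HarishChandra1970, Lemma 22; Lemma 42] [cite: DeitmarEchterhoff2014, Thm. 1.5.3] -/
theorem integral_mul_eq_integral_classOrbitalIntegral_density_of_tubeJacobian_local
    (hns : ∀ w : PlacesOver L v, IsCMField.complexConj L • w.1 = w.1)
    [MeasurableSpace ↥(unitaryGroupOfForm (conjLocal L (IsCMField.complexConj L) v) (cmLocalForm L 3 v))] [BorelSpace ↥(unitaryGroupOfForm (conjLocal L (IsCMField.complexConj L) v) (cmLocalForm L 3 v))] [LocallyCompactSpace ↥(unitaryGroupOfForm (conjLocal L (IsCMField.complexConj L) v) (cmLocalForm L 3 v))] [SecondCountableTopology ↥(unitaryGroupOfForm (conjLocal L (IsCMField.complexConj L) v) (cmLocalForm L 3 v))] [T2Space ↥(unitaryGroupOfForm (conjLocal L (IsCMField.complexConj L) v) (cmLocalForm L 3 v))]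
    [∀ γ : ↥(unitaryGroupOfForm (conjLocal L (IsCMField.complexConj L) v) (cmLocalForm L 3 v)), MeasurableSpace (↥(unitaryGroupOfForm (conjLocal L (IsCMField.complexConj L) v) (cmLocalForm L 3 v)) ⧸ Subgroup.centralizer ({γ} : Set ↥(unitaryGroupOfForm (conjLocal L (IsCMField.complexConj L) v) (cmLocalForm L 3 v))))] [∀ γ : ↥(unitaryGroupOfForm (conjLocal L (IsCMField.complexConj L) v) (cmLocalForm L 3 v)), BorelSpace (↥(unitaryGroupOfForm (conjLocal L (IsCMField.complexConj L) v) (cmLocalForm L 3 v)) ⧸ Subgroup.centralizer ({γ} : Set ↥(unitaryGroupOfForm (conjLocal L (IsCMField.complexConj L) v) (cmLocalForm L 3 v))))]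
    [MeasurableSpace ((LocalRing L v)ˣ × ↥(normOneUnits (conjLocal L (IsCMField.complexConj L) v)))] [BorelSpace ((LocalRing L v)ˣ × ↥(normOneUnits (conjLocal L (IsCMField.complexConj L) v)))]
    (ν : Measure ↥(unitaryGroupOfForm (conjLocal L (IsCMField.complexConj L) v) (cmLocalForm L 3 v))) [ν.IsHaarMeasure] [ν.IsMulRightInvariant]
    {mQv : OrbitalMeasureFamily ↥(unitaryGroupOfForm (conjLocal L (IsCMField.complexConj L) v) (cmLocalForm L 3 v))} (hcanQ : mQv.IsCanonical (fun γ => IsRegularElt (γ.val : GL (Fin 3) (LocalRing L v))) ν)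
    (μM : Measure ((LocalRing L v)ˣ × ↥(normOneUnits (conjLocal L (IsCMField.complexConj L) v)))) [μM.IsHaarMeasure]
    (w : ↥(unitaryGroupOfForm (conjLocal L (IsCMField.complexConj L) v) (cmLocalForm L 3 v))) (hw : Units.val (w : GL (Fin 3) (LocalRing L v)) = cmLocalForm L 3 v)
    (D : ↥(cmBorelTriple L 3 v).M → ℝ≥0) (hD : Measurable D)
    (hJacLoc : letI : MeasurableSpace (↥(unitaryGroupOfForm (conjLocal L (IsCMField.complexConj L) v) (cmLocalForm L 3 v)) ⧸ (cmBorelTriple L 3 v).M) := borel _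
      haveI : BorelSpace (↥(unitaryGroupOfForm (conjLocal L (IsCMField.complexConj L) v) (cmLocalForm L 3 v)) ⧸ (cmBorelTriple L 3 v).M) := ⟨rfl⟩
      ∀ (tT : Measure ↥(cmBorelTriple L 3 v).M) (_ : tT.IsHaarMeasure) (_ : tT.IsInvInvariant), tT (compactCore ↥(cmBorelTriple L 3 v).M) = 1 →
        ∀ t₀ : ↥(cmBorelTriple L 3 v).M, IsRegularElt (((t₀ : ↥(unitaryGroupOfForm (conjLocal L (IsCMField.complexConj L) v) (cmLocalForm L 3 v)))) : GL (Fin 3) (LocalRing L v)) →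
        ∃ U : Set ↥(cmBorelTriple L 3 v).M, IsOpen U ∧ t₀ ∈ U ∧
        ∃ A₀ : Set (↥(unitaryGroupOfForm (conjLocal L (IsCMField.complexConj L) v) (cmLocalForm L 3 v)) ⧸ (cmBorelTriple L 3 v).M), MeasurableSet A₀ ∧
          quotientMeasure (cmBorelTriple L 3 v).M tT (isClosed_cmBorelTriple_M L v) ν A₀ ≠ 0 ∧ quotientMeasure (cmBorelTriple L 3 v).M tT (isClosed_cmBorelTriple_M L v) ν A₀ ≠ ∞ ∧
          ∀ V : Set ↥(cmBorelTriple L 3 v).M, MeasurableSet V → V ⊆ U → (∀ t ∈ V, IsRegularElt (((t : ↥(unitaryGroupOfForm (conjLocal L (IsCMField.complexConj L) v) (cmLocalForm L 3 v)))) : GL (Fin 3) (LocalRing L v))) →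
            (∀ t ∈ V, ∀ t' ∈ V, ((t' : ↥(cmBorelTriple L 3 v).M) : ↥(unitaryGroupOfForm (conjLocal L (IsCMField.complexConj L) v) (cmLocalForm L 3 v))) ≠ w * t * w⁻¹) →
              ν {y : ↥(unitaryGroupOfForm (conjLocal L (IsCMField.complexConj L) v) (cmLocalForm L 3 v)) | ∃ (x : ↥(unitaryGroupOfForm (conjLocal L (IsCMField.complexConj L) v) (cmLocalForm L 3 v))) (t : ↥(cmBorelTriple L 3 v).M), (QuotientGroup.mk x : ↥(unitaryGroupOfForm (conjLocal L (IsCMField.complexConj L) v) (cmLocalForm L 3 v)) ⧸ (cmBorelTriple L 3 v).M) ∈ A₀ ∧ t ∈ V ∧ y = x * t * x⁻¹} =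
                quotientMeasure (cmBorelTriple L 3 v).M tT (isClosed_cmBorelTriple_M L v) ν A₀ * ∫⁻ t in V, (D t : ℝ≥0∞) ∂tT) :
    ∀ α : ↥(unitaryGroupOfForm (conjLocal L (IsCMField.complexConj L) v) (cmLocalForm L 3 v)) → ℂ, Measurable α → LocallyIntegrable α ν →
      (∀ x : ↥(unitaryGroupOfForm (conjLocal L (IsCMField.complexConj L) v) (cmLocalForm L 3 v)), x ∈ (hyperbolicSet L v : Set ↥(unitaryGroupOfForm (conjLocal L (IsCMField.complexConj L) v) (cmLocalForm L 3 v))) → ∀ h : ↥(unitaryGroupOfForm (conjLocal L (IsCMField.complexConj L) v) (cmLocalForm L 3 v)), α (h * x * h⁻¹) = α x) →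
      ∀ φ : ↥(unitaryGroupOfForm (conjLocal L (IsCMField.complexConj L) v) (cmLocalForm L 3 v)) → ℂ, IsLocSmooth φ → tsupport φ ⊆ (hyperbolicSet L v : Set ↥(unitaryGroupOfForm (conjLocal L (IsCMField.complexConj L) v) (cmLocalForm L 3 v))) →
        ∫ x, φ x * α x ∂ν =
          ∫ m, classOrbitalIntegral mQv φ (ConjClasses.mk (((torusChart L v m : ↥(cmBorelTriple L 3 v).M) : ↥(unitaryGroupOfForm (conjLocal L (IsCMField.complexConj L) v) (cmLocalForm L 3 v))))) *
            ((((2 * ((μM.map (torusChart L v)) (compactCore ↥(cmBorelTriple L 3 v).M)).toReal)⁻¹ * (D (torusChart L v m) : ℝ) : ℝ) : ℂ) *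
              α ((torusChart L v m : ↥(cmBorelTriple L 3 v).M) : ↥(unitaryGroupOfForm (conjLocal L (IsCMField.complexConj L) v) (cmLocalForm L 3 v)))) ∂μM := by
  intro α hαm hαli hαinv φ hφ hsupp
  classical
  letI : MeasurableSpace (↥(unitaryGroupOfForm (conjLocal L (IsCMField.complexConj L) v) (cmLocalForm L 3 v)) ⧸ (cmBorelTriple L 3 v).M) := borel _
  haveI : BorelSpace (↥(unitaryGroupOfForm (conjLocal L (IsCMField.complexConj L) v) (cmLocalForm L 3 v)) ⧸ (cmBorelTriple L 3 v).M) := ⟨rfl⟩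
  have hT := isClosed_cmBorelTriple_M L v
  haveI := hT
  have hTc : ∀ a ∈ (cmBorelTriple L 3 v).M, ∀ b ∈ (cmBorelTriple L 3 v).M, a * b = b * a := fun a ha b hb => mul_comm_of_mem_torusU_cmLocal L v ha hb
  haveI : LocallyCompactSpace ↥(cmBorelTriple L 3 v).M := hT.isClosedEmbedding_subtypeVal.locallyCompactSpace
  haveI : SecondCountableTopology ↥(cmBorelTriple L 3 v).M := TopologicalSpace.Subtype.secondCountableTopology _
  -- §a the Haar measure `tm = ι_* μM` on `T`, the constant `c₀`, THE normalised measure `tT`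
  set tm : Measure ↥(cmBorelTriple L 3 v).M := μM.map (torusChart L v) with htm
  haveI : tm.IsHaarMeasure := isHaarMeasure_map_torusChart L v μM
  haveI := F0P3cStCharTSTorusRay.secondCountableTopology_torus L v
  haveI := F0P3cStCharTSTorusRay.locallyCompactSpace_torus L v
  haveI : μM.Regular := inferInstance
  haveI : μM.IsInvInvariant := inferInstance
  haveI : tm.IsInvInvariant := by
    rw [htm, ← coe_torusChartEquiv]
    exact isInvInvariant_map_mulEquiv (torusChartEquiv L v).toMulEquiv (torusChartEquiv L v).continuous.measurable μM
  obtain ⟨hcoreC, hcoreO⟩ := isCompact_isOpen_compactCore_cmTorus L v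
  set c₀ : ℝ≥0∞ := tm (compactCore ↥(cmBorelTriple L 3 v).M) with hc₀
  have hc0 : c₀ ≠ 0 := (hcoreO.measure_pos tm ⟨1, one_mem_compactCore⟩).ne'
  have hctop : c₀ ≠ ∞ := hcoreC.measure_lt_top.ne
  set tT : Measure ↥(cmBorelTriple L 3 v).M := c₀⁻¹ • tm with htT
  haveI : tT.IsHaarMeasure := Measure.IsHaarMeasure.smul tm (ENNReal.inv_ne_zero.2 hctop) (ENNReal.inv_ne_top.2 hc0)
  haveI : tT.IsInvInvariant := ⟨by rw [Measure.inv_def, htT, Measure.map_smul, ← Measure.inv_def, Measure.inv_eq_self]⟩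
  have htT1 : tT (compactCore ↥(cmBorelTriple L 3 v).M) = 1 := by
    rw [htT, Measure.smul_apply, smul_eq_mul, ENNReal.inv_mul_cancel hc0 hctop]
  -- §b the conjugation family; the LOCAL socket at `tT` in ★ p851645's tube shape
  obtain ⟨Φ, hΦ⟩ := exists_conjFamily (cmBorelTriple L 3 v).M hTc
  have hJ := hJacLoc tT inferInstance inferInstance htT1
  have htube : ∀ (A₀ : Set (↥(unitaryGroupOfForm (conjLocal L (IsCMField.complexConj L) v) (cmLocalForm L 3 v)) ⧸ (cmBorelTriple L 3 v).M)) (V : Set ↥(cmBorelTriple L 3 v).M), Φ '' (A₀ ×ˢ V) =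
      {y : ↥(unitaryGroupOfForm (conjLocal L (IsCMField.complexConj L) v) (cmLocalForm L 3 v)) | ∃ (x : ↥(unitaryGroupOfForm (conjLocal L (IsCMField.complexConj L) v) (cmLocalForm L 3 v))) (t : ↥(cmBorelTriple L 3 v).M), (QuotientGroup.mk x : ↥(unitaryGroupOfForm (conjLocal L (IsCMField.complexConj L) v) (cmLocalForm L 3 v)) ⧸ (cmBorelTriple L 3 v).M) ∈ A₀ ∧ t ∈ V ∧ y = x * t * x⁻¹} := by
    intro A₀ V
    ext y
    constructor
    · rintro ⟨⟨q, t⟩, ⟨hq, ht⟩, rfl⟩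
      obtain ⟨x, rfl⟩ := QuotientGroup.mk_surjective q
      exact ⟨x, t, hq, ht, hΦ x t⟩
    · rintro ⟨x, t, hx, ht, rfl⟩
      exact ⟨(QuotientGroup.mk x, t), ⟨hx, ht⟩, hΦ x t⟩
  have hJacLoc' : ∀ t₀ : ↥(cmBorelTriple L 3 v).M, IsRegularElt (((t₀ : ↥(unitaryGroupOfForm (conjLocal L (IsCMField.complexConj L) v) (cmLocalForm L 3 v)))) : GL (Fin 3) (LocalRing L v)) →
      ∃ U : Set ↥(cmBorelTriple L 3 v).M, IsOpen U ∧ t₀ ∈ U ∧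
        ∃ A₀ : Set (↥(unitaryGroupOfForm (conjLocal L (IsCMField.complexConj L) v) (cmLocalForm L 3 v)) ⧸ (cmBorelTriple L 3 v).M), MeasurableSet A₀ ∧ (quotientMeasure (cmBorelTriple L 3 v).M tT (isClosed_cmBorelTriple_M L v) ν) A₀ ≠ 0 ∧ (quotientMeasure (cmBorelTriple L 3 v).M tT (isClosed_cmBorelTriple_M L v) ν) A₀ ≠ ∞ ∧
          ∀ V : Set ↥(cmBorelTriple L 3 v).M, MeasurableSet V → V ⊆ U → (∀ t ∈ V, IsRegularElt (((t : ↥(unitaryGroupOfForm (conjLocal L (IsCMField.complexConj L) v) (cmLocalForm L 3 v)))) : GL (Fin 3) (LocalRing L v))) →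
            (∀ t ∈ V, ∀ t' ∈ V, ((t' : ↥(cmBorelTriple L 3 v).M) : ↥(unitaryGroupOfForm (conjLocal L (IsCMField.complexConj L) v) (cmLocalForm L 3 v))) ≠ w * t * w⁻¹) →
              ν (Φ '' (A₀ ×ˢ V)) = (quotientMeasure (cmBorelTriple L 3 v).M tT (isClosed_cmBorelTriple_M L v) ν) A₀ * ∫⁻ t in V, (D t : ℝ≥0∞) ∂tT := by
    intro t₀ ht₀
    obtain ⟨U, hUo, hU0, A₀, hA₀m, hA₀0, hA₀top, hJ'⟩ := hJ t₀ ht₀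
    exact ⟨U, hUo, hU0, A₀, hA₀m, hA₀0, hA₀top, fun V hVm hVU hVreg hVfree => by rw [htube]; exact hJ' V hVm hVU hVreg hVfree⟩
  -- §c ★ p851645 (Bochner form, LOCAL socket) at `g := φ · α`
  have hΩ := hyperbolicSet_eq_hypSet L v
  have hint : IntegrableOn (fun x => φ x * α x) (hyperbolicSet L v : Set ↥(unitaryGroupOfForm (conjLocal L (IsCMField.complexConj L) v) (cmLocalForm L 3 v))) ν := by
    have h := hαli.integrable_smul_left_of_hasCompactSupport hφ.continuous hφ.hasCompactSupport
    simp only [smul_eq_mul] at h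
    exact h.integrableOn
  have hφ0 : ∀ x : ↥(unitaryGroupOfForm (conjLocal L (IsCMField.complexConj L) v) (cmLocalForm L 3 v)), x ∉ (hyperbolicSet L v : Set ↥(unitaryGroupOfForm (conjLocal L (IsCMField.complexConj L) v) (cmLocalForm L 3 v))) → φ x = 0 := fun x hx => image_eq_zero_of_notMem_tsupport fun h => hx (hsupp h)
  rw [hΩ] at hint hφ0
  obtain ⟨-, heq⟩ := integral_hypSet_eq_of_tubeJacobian_local L v hns ν tT Φ hΦ w hw D hD hJacLoc' (fun x => φ x * α x) hint
  -- §d the inner fibre integral at a regular `t` is `α(t) · O^{can}_t(φ)`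
  have hinner : ∀ t : ↥(cmBorelTriple L 3 v).M, IsRegularElt (((t : ↥(unitaryGroupOfForm (conjLocal L (IsCMField.complexConj L) v) (cmLocalForm L 3 v)))) : GL (Fin 3) (LocalRing L v)) →
      ∫ q, φ (Φ (q, t)) * α (Φ (q, t)) ∂(quotientMeasure (cmBorelTriple L 3 v).M tT (isClosed_cmBorelTriple_M L v) ν) =
        classOrbitalIntegral mQv φ (ConjClasses.mk (t : ↥(unitaryGroupOfForm (conjLocal L (IsCMField.complexConj L) v) (cmLocalForm L 3 v)))) * α t := by
    intro t ht
    have htΩ : (t : ↥(unitaryGroupOfForm (conjLocal L (IsCMField.complexConj L) v) (cmLocalForm L 3 v))) ∈ {x | ∃ g t : ↥(unitaryGroupOfForm (conjLocal L (IsCMField.complexConj L) v) (cmLocalForm L 3 v)), t ∈ (cmBorelTriple L 3 v).M ∧ IsRegularElt (t : GL (Fin 3) (LocalRing L v)) ∧ g * t * g⁻¹ = x} := mem_hypSet_of_mem_torusU (conjLocal L (IsCMField.complexConj L) v) (cmLocalForm L 3 v) t.2 ht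
    rw [← hΩ] at htΩ
    have hpt : ∀ q, φ (Φ (q, t)) * α (Φ (q, t)) = φ (Φ (q, t)) * α t := by
      intro q
      induction q using QuotientGroup.induction_on with
      | H x => rw [hΦ, hαinv _ htΩ x]
    rw [integral_congr_ae (Eventually.of_forall hpt), integral_mul_const,
      classOrbitalIntegral_mk_eq_integral_conjFamily L v ν hcanQ tT htT1 Φ hΦ t ht φ hφ.continuous.measurable]
  -- §e assemble: `∫ φα = ½ ∫_{T^reg} D • (α · O) dtT = ½ ∫_T … dtT = ½ c₀⁻¹ ∫_M … ∘ ι dμM`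
  have hSm := (isOpen_setOf_isRegularElt_torusU (conjLocal L (IsCMField.complexConj L) v) (cmLocalForm L 3 v)
    (isUnit_of_ne_zero_of_nonsplit L v hns) (R := LocalRing L v)).measurableSet
  have h1 : ∫ x, φ x * α x ∂ν = ∫ x in {x | ∃ g t : ↥(unitaryGroupOfForm (conjLocal L (IsCMField.complexConj L) v) (cmLocalForm L 3 v)), t ∈ (cmBorelTriple L 3 v).M ∧ IsRegularElt (t : GL (Fin 3) (LocalRing L v)) ∧ g * t * g⁻¹ = x}, φ x * α x ∂ν :=
    (setIntegral_eq_integral_of_forall_compl_eq_zero fun x hx => by rw [hφ0 x hx, zero_mul]).symm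
  have h2 : ∫ t in {t : ↥(cmBorelTriple L 3 v).M | IsRegularElt (((t : ↥(unitaryGroupOfForm (conjLocal L (IsCMField.complexConj L) v) (cmLocalForm L 3 v)))) : GL (Fin 3) (LocalRing L v))},
      (D t : ℝ) • ∫ q, φ (Φ (q, t)) * α (Φ (q, t)) ∂(quotientMeasure (cmBorelTriple L 3 v).M tT (isClosed_cmBorelTriple_M L v) ν) ∂tT =
      ∫ t, (D t : ℝ) • (classOrbitalIntegral mQv φ (ConjClasses.mk (t : ↥(unitaryGroupOfForm (conjLocal L (IsCMField.complexConj L) v) (cmLocalForm L 3 v)))) * α t) ∂tT := by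
    have hae : ∀ᵐ t : ↥(cmBorelTriple L 3 v).M ∂tT, t ∈ {t : ↥(cmBorelTriple L 3 v).M | IsRegularElt (((t : ↥(unitaryGroupOfForm (conjLocal L (IsCMField.complexConj L) v) (cmLocalForm L 3 v)))) : GL (Fin 3) (LocalRing L v))} :=
      ae_isRegularElt_cmTorus L v tT
    rw [setIntegral_congr_fun hSm fun t ht => by rw [hinner t ht], Measure.restrict_eq_self_of_ae_mem hae]
  have h3 : (2 : ℝ) • ∫ x, φ x * α x ∂ν =
      ∫ t, (D t : ℝ) • (classOrbitalIntegral mQv φ (ConjClasses.mk (t : ↥(unitaryGroupOfForm (conjLocal L (IsCMField.complexConj L) v) (cmLocalForm L 3 v)))) * α t) ∂tT := by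
    rw [h1, ← heq, h2]
  have h4 : ∫ t, (D t : ℝ) • (classOrbitalIntegral mQv φ (ConjClasses.mk (t : ↥(unitaryGroupOfForm (conjLocal L (IsCMField.complexConj L) v) (cmLocalForm L 3 v)))) * α t) ∂tT =
      (c₀⁻¹).toReal • ∫ m, (D (torusChart L v m) : ℝ) •
        (classOrbitalIntegral mQv φ (ConjClasses.mk (((torusChart L v m : ↥(cmBorelTriple L 3 v).M) : ↥(unitaryGroupOfForm (conjLocal L (IsCMField.complexConj L) v) (cmLocalForm L 3 v))))) * α ((torusChart L v m : ↥(cmBorelTriple L 3 v).M) : ↥(unitaryGroupOfForm (conjLocal L (IsCMField.complexConj L) v) (cmLocalForm L 3 v)))) ∂μM := by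
    rw [htT, integral_smul_measure, htm, integral_comp_torusChart]
  calc ∫ x, φ x * α x ∂ν = (2 : ℝ)⁻¹ • ((2 : ℝ) • ∫ x, φ x * α x ∂ν) := by
        rw [smul_smul, inv_mul_cancel₀ (two_ne_zero' ℝ), one_smul]
    _ = (2 : ℝ)⁻¹ • ((c₀⁻¹).toReal • ∫ m, (D (torusChart L v m) : ℝ) •
          (classOrbitalIntegral mQv φ (ConjClasses.mk (((torusChart L v m : ↥(cmBorelTriple L 3 v).M) : ↥(unitaryGroupOfForm (conjLocal L (IsCMField.complexConj L) v) (cmLocalForm L 3 v))))) *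
            α ((torusChart L v m : ↥(cmBorelTriple L 3 v).M) : ↥(unitaryGroupOfForm (conjLocal L (IsCMField.complexConj L) v) (cmLocalForm L 3 v)))) ∂μM) := by rw [h3, h4]
    _ = ∫ m, (2 : ℝ)⁻¹ • ((c₀⁻¹).toReal • ((D (torusChart L v m) : ℝ) •
          (classOrbitalIntegral mQv φ (ConjClasses.mk (((torusChart L v m : ↥(cmBorelTriple L 3 v).M) : ↥(unitaryGroupOfForm (conjLocal L (IsCMField.complexConj L) v) (cmLocalForm L 3 v))))) *
            α ((torusChart L v m : ↥(cmBorelTriple L 3 v).M) : ↥(unitaryGroupOfForm (conjLocal L (IsCMField.complexConj L) v) (cmLocalForm L 3 v)))))) ∂μM := by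
        rw [← integral_smul, ← integral_smul]
    _ = _ := integral_congr_ae (Eventually.of_forall fun m => by
        simp only [Complex.real_smul, ENNReal.toReal_inv]
        push_cast
        ring)

end CM

end Summit.HodgeConjecture.HodgeConjecture.Cruxes.H413.F0P3cStCharTSWeylHypWIFJacLocal
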